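import Summits.RiemannHypothesis.RiemannHypothesis.Theorems.Splittings.ScrewWolffDiscreteDataA

/-!
# Discrete Wolff data («divisor rings») — part B: radii, roots of unity, atoms, weights

Continuation of `ScrewWolffDiscreteDataA` (same namespace; see its module docstring for the construction and
the lane context: cell `rh-split`, gen-15 POSTSCRIPT, census V106).  ζ-free and RH-free.
-/

set_option linter.dupNamespace false

namespace Summit.RiemannHypothesis.RiemannHypothesis.Theorems.Splittings.ScrewWolffDiscreteData

open Complex Finset Filter Topology

noncomputable section

/-! ## 5. Radii and roots of unity -/

/-- The radius of ring `n` after `M`-fold root extraction: `q^{1/(nM)}`. -/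
def rad (n M : ℕ) : ℝ := q ^ (1 / ((n : ℝ) * M))

/-- Ring radii are positive. -/
theorem rad_pos (n M : ℕ) : 0 < rad n M := Real.rpow_pos_of_pos q_pos _

/-- Ring radii lie strictly inside the unit circle. -/
theorem rad_lt_one {n M : ℕ} (hn : 1 ≤ n) (hM : 1 ≤ M) : rad n M < 1 :=
  Real.rpow_lt_one q_pos.le q_lt_one (by positivity)

/-- Ring radii are monotone in the level. -/
theorem rad_le_rad {n n' M : ℕ} (hn : 1 ≤ n) (hM : 1 ≤ M) (h : n ≤ n') : rad n M ≤ rad n' M := by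
  apply Real.rpow_le_rpow_of_exponent_ge q_pos q_lt_one.le
  have : (0 : ℝ) < n := by exact_mod_cast hn
  have : (0 : ℝ) < M := by exact_mod_cast hM
  gcongr

/-- Ring radii are strictly monotone in the level. -/
theorem rad_lt_rad {n n' M : ℕ} (hn : 1 ≤ n) (hM : 1 ≤ M) (h : n < n') : rad n M < rad n' M := by
  apply Real.rpow_lt_rpow_of_exponent_gt q_pos q_lt_one
  have : (0 : ℝ) < n := by exact_mod_cast hn
  have : (0 : ℝ) < M := by exact_mod_cast hM
  gcongr

/-- `(q^{1/(nM)})^{nM·m} = q^m`. -/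
theorem rad_pow (n M m : ℕ) (hn : 1 ≤ n) (hM : 1 ≤ M) : rad n M ^ (n * M * m) = q ^ m := by
  rw [rad, ← Real.rpow_natCast, ← Real.rpow_mul q_pos.le, ← Real.rpow_natCast]
  congr 1
  have : (n : ℝ) * M ≠ 0 := by positivity
  push_cast
  field_simp

/-- For every `ρ < 1` some radius `q^{1/N}` exceeds `ρ`. -/
theorem exists_rad_gt {ρ : ℝ} (hρ : ρ < 1) : ∃ N : ℕ, 1 ≤ N ∧ ρ < rad N 1 := by
  have hc : ContinuousAt (fun x : ℝ ↦ q ^ x) 0 := Real.continuousAt_const_rpow q_ne_zero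
  have hev : ∀ᶠ x in 𝓝 (0 : ℝ), ρ < q ^ x := by
    apply hc.eventually (lt_mem_nhds _)
    simpa using hρ
  have ht : Tendsto (fun N : ℕ ↦ 1 / ((N : ℝ) * 1)) atTop (𝓝 0) := by
    simpa using tendsto_one_div_atTop_nhds_zero_nat (𝕜 := ℝ)
  obtain ⟨N₀, hN₀⟩ := eventually_atTop.1 (ht.eventually hev)
  refine ⟨max N₀ 1, le_max_right _ _, ?_⟩
  have := hN₀ (max N₀ 1) (le_max_left _ _)
  simpa [rad] using this

/-- The primitive `N`-th root of unity `e^{2πi/N}`. -/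
def ω (N : ℕ) : ℂ := Complex.exp (2 * Real.pi * I / N)

/-- `ω N` is a primitive `N`-th root of unity. -/
theorem ω_isPrimitiveRoot {N : ℕ} (hN : N ≠ 0) : IsPrimitiveRoot (ω N) N :=
  Complex.isPrimitiveRoot_exp N hN

/-- `ω N` has norm one. -/
theorem norm_ω (N : ℕ) : ‖ω N‖ = 1 := by
  rw [ω, show (2 * Real.pi * I / N : ℂ) = ((2 * Real.pi / N : ℝ) : ℂ) * I by push_cast; ring,
    Complex.norm_exp_ofReal_mul_I]

/-- **Roots-of-unity filter**: `Σ_{l<N} (ω^k)^l = N·[N ∣ k]`. -/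
theorem sum_ω_pow {N : ℕ} (hN : N ≠ 0) (k : ℕ) :
    ∑ l : Fin N, (ω N ^ k) ^ (l : ℕ) = if N ∣ k then (N : ℂ) else 0 := by
  have hprim := ω_isPrimitiveRoot hN
  rw [Fin.sum_univ_eq_sum_range (fun l ↦ (ω N ^ k) ^ l)]
  split_ifs with hdvd
  · rw [(hprim.pow_eq_one_iff_dvd k).2 hdvd]
    simp
  · have hne : ω N ^ k ≠ 1 := fun h ↦ hdvd ((hprim.pow_eq_one_iff_dvd k).1 h)
    rw [geom_sum_eq hne, ← pow_mul, mul_comm, pow_mul, hprim.pow_eq_one, one_pow, sub_self, zero_div]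

/-! ## 6. The atoms -/

/-- Live ring indices (`c n ≠ 0`, hence `n ≥ 2`). -/
abbrev Live : Type := {n : ℕ // coef n ≠ 0}

/-- Index type of the atoms: `2M` seed atoms and `nM` atoms on each live ring `n`. -/
abbrev Idx (M : ℕ) : Type := Fin (2 * M) ⊕ (Σ n : Live, Fin (n.1 * M))

/-- Direction of ring `n`: `wdir n M ^ (nM) = udir (c n)`. -/
def wdir (n M : ℕ) : ℂ := Complex.exp (((arg (udir (coef n)) / ((n : ℝ) * M) : ℝ) : ℂ) * I)

/-- The ring direction `wdir n M` has norm one. -/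
theorem norm_wdir (n M : ℕ) : ‖wdir n M‖ = 1 := by
  rw [wdir, Complex.norm_exp_ofReal_mul_I]

/-- The `(n·M)`-th power of the ring direction is the direction of `coef n`. -/
theorem wdir_pow {n M : ℕ} (hn : 1 ≤ n) (hM : 1 ≤ M) : wdir n M ^ (n * M) = udir (coef n) := by
  rw [wdir, ← Complex.exp_nat_mul]
  conv_rhs => rw [← exp_arg_udir (coef n)]
  congr 1
  have hn0 : (n : ℂ) ≠ 0 := by exact_mod_cast (show n ≠ 0 by omega)
  have hM0 : (M : ℂ) ≠ 0 := by exact_mod_cast (show M ≠ 0 by omega)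
  push_cast
  field_simp

/-- The atoms (unit-disc normalisation). -/
def atom (M : ℕ) : Idx M → ℂ
  | Sum.inl l => (rad 1 M : ℂ) * ω (2 * M) ^ (l : ℕ)
  | Sum.inr ⟨n, l⟩ => (rad n.1 M : ℂ) * wdir n.1 M * ω (n.1 * M) ^ (l : ℕ)

/-- The weights. -/
def wt (M : ℕ) : Idx M → ℝ
  | Sum.inl _ => 1 / (2 * (M : ℝ))
  | Sum.inr ⟨n, _⟩ => ‖coef n.1‖ / ((n.1 : ℝ) * M)

/-- The ring level of an atom (`1` for the seed). -/
def level {M : ℕ} : Idx M → ℕ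
  | Sum.inl _ => 1
  | Sum.inr ⟨n, _⟩ => n.1

/-- Every atom index has level at least one. -/
theorem one_le_level {M : ℕ} (i : Idx M) : 1 ≤ level i := by
  rcases i with l | ⟨n, l⟩
  · simp [level]
  · simp only [level]; have := coef_ne_zero_two_le n.2; omega

/-- An atom of level `n` lies on the circle of radius `rad n M`. -/
theorem norm_atom {M : ℕ} (i : Idx M) : ‖atom M i‖ = rad (level i) M := by
  rcases i with l | ⟨n, l⟩
  · simp only [atom, level, norm_mul, norm_pow, norm_ω, one_pow, mul_one, Complex.norm_real, Real.norm_eq_abs,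
      abs_of_pos (rad_pos _ _)]
  · simp only [atom, level, norm_mul, norm_pow, norm_ω, norm_wdir, one_pow, mul_one, Complex.norm_real,
      Real.norm_eq_abs, abs_of_pos (rad_pos _ _)]

/-- All atom weights are positive. -/
theorem wt_pos {M : ℕ} (hM : 1 ≤ M) (i : Idx M) : 0 < wt M i := by
  have : (0 : ℝ) < M := by exact_mod_cast hM
  rcases i with l | ⟨n, l⟩
  · simp only [wt]; positivity
  · simp only [wt]
    have h2 := coef_ne_zero_two_le n.2
    have : (0 : ℝ) < n.1 := by exact_mod_cast (show 0 < n.1 by omega)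
    exact div_pos (norm_pos_iff.mpr n.2) (by positivity)

/-! ## 7. Summability of the weights -/

/-- The atom weights are summable. -/
theorem summable_wt {M : ℕ} (hM : 1 ≤ M) : Summable (wt M) := by
  refine Summable.sum _ ?_ ?_
  · exact (hasSum_fintype _).summable
  · -- the ring part: a sigma family of nonnegative terms, ring `n` totalling `‖c n‖`
    have hnn : ∀ x : (Σ n : Live, Fin (n.1 * M)), 0 ≤ (wt M ∘ Sum.inr) x := by
      rintro ⟨n, l⟩; simp only [Function.comp, wt]; positivity
    refine (summable_sigma_of_nonneg hnn).2 ⟨fun n ↦ (hasSum_fintype _).summable, ?_⟩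
    have heq : (fun n : Live ↦ ∑' l : Fin (n.1 * M), (wt M ∘ Sum.inr) ⟨n, l⟩) = fun n : Live ↦ ‖coef n.1‖ := by
      funext n
      rw [tsum_fintype]
      simp only [Function.comp, wt, Finset.sum_const, Finset.card_univ, Fintype.card_fin, nsmul_eq_mul]
      have h2 := coef_ne_zero_two_le n.2
      have : (0 : ℝ) < n.1 := by exact_mod_cast (show 0 < n.1 by omega)
      have : (0 : ℝ) < M := by exact_mod_cast hM
      push_cast
      field_simp
    rw [heq]
    exact summable_norm_coef.comp_injective Subtype.val_injective

end

end Summit.RiemannHypothesis.RiemannHypothesis.Theorems.Splittings.ScrewWolffDiscreteData
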